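import Literature.Topology.FourManifolds.TautFoliationsContourSquare
import HarnessLib

/-!
# Contour lines of the cone of a square with a floor apex

Topic: sequel to `TautFoliationsContourSquare.lean`. With a **floor apex** `m < ψ q` for all
boundary points `q`, the height of the cone `coneHt x = (1 - radial x) m + radial x · ψ (proj x)`
is **strictly increasing along every ray**, and the level set of height `h > m` is the graph
`q ↦ levelPt q h` over the boundary arc `{q | h ≤ ψ q}`. Everything follows from the roof case
applied to `-ψ`, `-m`, `-h` (`coneHt_neg`, `levelPt_neg`). In the construction of the induced
foliation of a disc in cone position, roof and floor apexes alternate on a checkerboard, which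
makes every edge point regular. All statements are [folklore].
-/

open Set Filter Metric Topology

namespace Literature.Topology.FourManifolds

namespace ConeSquare

variable {c : ℝ × ℝ} {ℓ m : ℝ} {ψ : ℝ × ℝ → ℝ} {x q : ℝ × ℝ} {h t : ℝ}

/-- Negating the data negates the height. [folklore] -/
theorem coneHt_neg (c : ℝ × ℝ) (ℓ m : ℝ) (ψ : ℝ × ℝ → ℝ) (x : ℝ × ℝ) :
    coneHt c ℓ (-m) (fun y ↦ -ψ y) x = -coneHt c ℓ m ψ x := by
  simp only [coneHt_apply]; ring

/-- Negating the data does not change the level points (with negated height). [folklore] -/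
theorem levelPt_neg (c : ℝ × ℝ) (m : ℝ) (ψ : ℝ × ℝ → ℝ) (q : ℝ × ℝ) (h : ℝ) :
    levelPt c (-m) (fun y ↦ -ψ y) q (-h) = levelPt c m ψ q h := by
  simp only [levelPt]
  congr 1
  rw [show (-m - -h) / (-m - -ψ q) = (m - h) / (m - ψ q) by
    rw [← neg_div_neg_eq]; congr 1 <;> ring]

/-- **Floor apex: the height is strictly increasing along every ray.** [folklore] -/
theorem strictMonoOn_coneHt_ray (hℓ : 0 < ℓ) (hq : q ∈ sphere c ℓ) (hm : m < ψ q) :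
    StrictMonoOn (fun t : ℝ ↦ coneHt c ℓ m ψ (c + t • (q - c))) (Ici 0) := by
  intro s hs t ht hst
  simp only
  rw [coneHt_ray hℓ hq hs, coneHt_ray hℓ hq ht]
  nlinarith

/-- Floor apex: off the centre the height is `> m`. [folklore] -/
theorem apex_lt_coneHt (hℓ : 0 < ℓ) (hm : ∀ q ∈ sphere c ℓ, m < ψ q) (hxc : x ≠ c) : m < coneHt c ℓ m ψ x := by
  have h := coneHt_lt_apex (m := -m) (ψ := fun y ↦ -ψ y) hℓ (fun q hq ↦ by linarith [hm q hq]) hxc (c := c)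
  rw [coneHt_neg] at h
  linarith

/-- Floor apex: in the square the height is `≤ ψ (proj x)`. [folklore] -/
theorem coneHt_le (hℓ : 0 < ℓ) (hm : ∀ q ∈ sphere c ℓ, m < ψ q) (hx : x ∈ closedBall c ℓ) :
    coneHt c ℓ m ψ x ≤ ψ (proj c ℓ x) := by
  have h := le_coneHt (m := -m) (ψ := fun y ↦ -ψ y) hℓ (fun q hq ↦ by linarith [hm q hq]) hx (c := c)
  rw [coneHt_neg] at h
  linarith

/-- Floor apex: `levelPt` has height `h` (`m ≤ h`). [folklore] -/
theorem coneHt_levelPt_floor (hℓ : 0 < ℓ) (hq : q ∈ sphere c ℓ) (hm : m < ψ q) (hh : m ≤ h) :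
    coneHt c ℓ m ψ (levelPt c m ψ q h) = h := by
  have h1 := coneHt_levelPt (m := -m) (ψ := fun y ↦ -ψ y) (h := -h) hℓ hq (by linarith) (by linarith) (c := c)
  rw [levelPt_neg, coneHt_neg] at h1
  linarith

/-- Floor apex: `levelPt` lies in the square iff `h ≤ ψ q`. [folklore] -/
theorem levelPt_mem_closedBall_iff_floor (hℓ : 0 < ℓ) (hq : q ∈ sphere c ℓ) (hm : m < ψ q) (hh : m ≤ h) :
    levelPt c m ψ q h ∈ closedBall c ℓ ↔ h ≤ ψ q := by
  have h1 := levelPt_mem_closedBall_iff (m := -m) (ψ := fun y ↦ -ψ y) (h := -h) hℓ hq (by linarith) (by linarith) (c := c)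
  rw [levelPt_neg] at h1
  rw [h1]
  constructor <;> intro h' <;> linarith

/-- Floor apex: `levelPt` lies strictly inside the square iff `h < ψ q`. [folklore] -/
theorem levelPt_mem_ball_iff_floor (hℓ : 0 < ℓ) (hq : q ∈ sphere c ℓ) (hm : m < ψ q) (hh : m ≤ h) :
    levelPt c m ψ q h ∈ ball c ℓ ↔ h < ψ q := by
  have h1 := levelPt_mem_ball_iff (m := -m) (ψ := fun y ↦ -ψ y) (h := -h) hℓ hq (by linarith) (by linarith) (c := c)
  rw [levelPt_neg] at h1
  rw [h1]
  constructor <;> intro h' <;> linarith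

/-- Floor apex: `levelPt` is on the boundary iff `h = ψ q`. [folklore] -/
theorem levelPt_mem_sphere_iff_floor (hℓ : 0 < ℓ) (hq : q ∈ sphere c ℓ) (hm : m < ψ q) (hh : m ≤ h) :
    levelPt c m ψ q h ∈ sphere c ℓ ↔ ψ q = h := by
  have h1 := levelPt_mem_sphere_iff (m := -m) (ψ := fun y ↦ -ψ y) (h := -h) hℓ hq (by linarith) (by linarith) (c := c)
  rw [levelPt_neg] at h1
  rw [h1]
  constructor <;> intro h' <;> linarith

/-- Floor apex: a point of the square at height `h` is the level point of its projection.
[folklore] -/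
theorem eq_levelPt_of_coneHt_eq_floor (hℓ : 0 < ℓ) (hm : ∀ q ∈ sphere c ℓ, m < ψ q) (hx : coneHt c ℓ m ψ x = h) :
    x = levelPt c m ψ (proj c ℓ x) h := by
  have h1 := eq_levelPt_of_coneHt_eq (m := -m) (ψ := fun y ↦ -ψ y) (h := -h) hℓ (fun q hq ↦ by linarith [hm q hq])
    (by rw [coneHt_neg, hx]) (c := c) (x := x)
  rwa [levelPt_neg] at h1

/-- **Floor apex: the level set of height `h > m`** is the set of level points over
`{q | h ≤ ψ q}`. [folklore] -/
theorem coneHt_eq_iff_floor (hℓ : 0 < ℓ) (hm : ∀ q ∈ sphere c ℓ, m < ψ q) (hh : m < h) (hx : x ∈ closedBall c ℓ) :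
    coneHt c ℓ m ψ x = h ↔ ∃ q ∈ sphere c ℓ, h ≤ ψ q ∧ x = levelPt c m ψ q h := by
  constructor
  · intro hxh
    refine ⟨proj c ℓ x, proj_mem_sphere hℓ x, ?_, eq_levelPt_of_coneHt_eq_floor hℓ hm hxh⟩
    have := coneHt_le hℓ hm hx
    rwa [hxh] at this
  · rintro ⟨q, hq, -, rfl⟩
    exact coneHt_levelPt_floor hℓ hq (hm q hq) hh.le

end ConeSquare

end Literature.Topology.FourManifolds
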